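import Literature.Probability.RandomPlanarGeometry.SAWFrames
import HarnessLib

/-!
# The two parallel lanes of the inserted excursion (from the sphere to the arena)

Part of the sorry-free replacement for the link polygon of H. Duminil-Copin, G. Kozma,
A. Yadin, *Supercritical self-avoiding walks are space-filling*, Ann. IHP Probab. Stat. 50
(2014), §3 (proof of Proposition 7). In the lane frame `F` (centre `z₀`), the template leaves
the free ball at the anti-diagonal pair `L = fr α (β+1)`, `R = fr (α+1) β` with `α ≥ 0` and
`β` large; the excursion descends along two disjoint LANES to two adjacent sites of the top row
`y = yu` of the arena (`xr` its right abscissa, `0 < xr`):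

* class V (`α + 1 ≤ xr`): the columns `α` and `α + 1` straight down to the row `yu`;
* class BR (`xr ≤ α`): the right lane goes down the column `α + 1` to the row `yu` and west
  along it to the corner `(xr, yu)`; the left lane goes down the column `α` to the row `yu + 1`,
  west along it to `(xr - 1, yu + 1)` and down to `(xr - 1, yu)`.

`laneL`, `laneR` (vertex lists from `L`, `R` to the arrivals `arrL = fr (min α (xr-1)) yu`,
`arrR = fr (min (α+1) xr) yu`) are disjoint self-avoiding chains (`lanes_spec`), and their
sites are confined to explicit coordinate ranges (`mem_laneL`, `mem_laneR`): abscissa in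
`[0, α+1]`, ordinate in `[yu, β+1]`, `fx + fy ≤ α + β + 1` (so inside the free ball of
`ℓ¹`-radius `α + β + 2 = d₀`), and on the row `yu` only at the arrivals.
-/

noncomputable section

open Finset Literature.Probability.LatticeModels

namespace Literature.Probability.RandomPlanarGeometry.SAW

namespace Frame

variable (F : Frame)

/-! ### Frame segments -/

/-- Moving `k` steps against `ey` from `fr a b` reaches `fr a (b - k)`. [folklore] -/
theorem fr_add_smul_neg_ey (a b k : ℤ) : F.fr a b + k • (-F.ey) = F.fr a (b - k) := by
  simp only [fr, smul_neg, sub_eq_add_neg, add_smul, neg_smul]; abel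

/-- Moving `k` steps against `ex` from `fr a b` reaches `fr (a - k) b`. [folklore] -/
theorem fr_add_smul_neg_ex (a b k : ℤ) : F.fr a b + k • (-F.ex) = F.fr (a - k) b := by
  simp only [fr, smul_neg, sub_eq_add_neg, add_smul, neg_smul]; abel

/-- `-ey` is a lattice step. [folklore] -/
theorem adj_zero_neg_ey : (zdGraph 2).Adj 0 (-F.ey) := by
  have h := F.adj_fr_iff 0 0 0 (-1)
  rw [show F.fr 0 (-1) = F.fr 0 0 + (1 : ℤ) • (-F.ey) by rw [F.fr_add_smul_neg_ey]; norm_num,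
    one_smul, fr_zero_zero] at h
  have h' : (zdGraph 2).Adj F.z₀ (F.z₀ + -F.ey) := h.2 (Or.inr ⟨Or.inr (by norm_num), rfl⟩)
  have := (zdGraph_adj_shift_iff (-F.z₀) F.z₀ (F.z₀ + -F.ey)).2 h'
  simpa [LatticeModels.Site.shift] using this

/-- `-ex` is a lattice step. [folklore] -/
theorem adj_zero_neg_ex : (zdGraph 2).Adj 0 (-F.ex) := by
  have h := F.adj_fr_iff 0 0 (-1) 0
  rw [show F.fr (-1) 0 = F.fr 0 0 + (1 : ℤ) • (-F.ex) by rw [F.fr_add_smul_neg_ex]; norm_num,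
    one_smul, fr_zero_zero] at h
  have h' : (zdGraph 2).Adj F.z₀ (F.z₀ + -F.ex) := h.2 (Or.inl ⟨Or.inr (by norm_num), rfl⟩)
  have := (zdGraph_adj_shift_iff (-F.z₀) F.z₀ (F.z₀ + -F.ex)).2 h'
  simpa [LatticeModels.Site.shift] using this

/-- `ey ≠ 0`. [folklore] -/
theorem neg_ey_ne_zero : -F.ey ≠ 0 := (F.adj_zero_neg_ey).ne.symm

/-- `ex ≠ 0`. [folklore] -/
theorem neg_ex_ne_zero : -F.ex ≠ 0 := (F.adj_zero_neg_ex).ne.symm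

/-- The vertical segment of `n` steps downwards from `fr a b`. [folklore] -/
def vDown (a b : ℤ) (n : ℕ) : List (Site 2) := seg (F.fr a b) (-F.ey) n

/-- The horizontal segment of `n` steps westwards from `fr a b`. [folklore] -/
def hWest (a b : ℤ) (n : ℕ) : List (Site 2) := seg (F.fr a b) (-F.ex) n

/-- Membership in a downward segment. [folklore] -/
theorem mem_vDown {a b : ℤ} {n : ℕ} {w : Site 2} :
    w ∈ F.vDown a b n ↔ ∃ k : ℕ, k ≤ n ∧ w = F.fr a (b - k) := by
  simp only [vDown, mem_seg_iff, fr_add_smul_neg_ey]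

/-- Membership in a westward segment. [folklore] -/
theorem mem_hWest {a b : ℤ} {n : ℕ} {w : Site 2} :
    w ∈ F.hWest a b n ↔ ∃ k : ℕ, k ≤ n ∧ w = F.fr (a - k) b := by
  simp only [hWest, mem_seg_iff, fr_add_smul_neg_ex]

/-- Coordinates on a downward segment. [folklore] -/
theorem coords_of_mem_vDown {a b : ℤ} {n : ℕ} {w : Site 2} (h : w ∈ F.vDown a b n) :
    F.fx w = a ∧ b - n ≤ F.fy w ∧ F.fy w ≤ b := by
  obtain ⟨k, hk, rfl⟩ := F.mem_vDown.1 h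
  have hk' : (k : ℤ) ≤ n := by exact_mod_cast hk
  rw [fx_fr, fy_fr]
  exact ⟨rfl, by linarith, by linarith⟩

/-- Coordinates on a westward segment. [folklore] -/
theorem coords_of_mem_hWest {a b : ℤ} {n : ℕ} {w : Site 2} (h : w ∈ F.hWest a b n) :
    F.fy w = b ∧ a - n ≤ F.fx w ∧ F.fx w ≤ a := by
  obtain ⟨k, hk, rfl⟩ := F.mem_hWest.1 h
  have hk' : (k : ℤ) ≤ n := by exact_mod_cast hk
  rw [fx_fr, fy_fr]
  exact ⟨rfl, by linarith, by linarith⟩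

/-- Downward segments: chain, no repetition, endpoints. [folklore] -/
theorem vDown_spec (a b : ℤ) (n : ℕ) :
    (F.vDown a b n).IsChain (zdGraph 2).Adj ∧ (F.vDown a b n).Nodup ∧
      (F.vDown a b n).head? = some (F.fr a b) ∧ (F.vDown a b n).getLast? = some (F.fr a (b - n)) ∧
      F.vDown a b n ≠ [] := by
  refine ⟨isChain_seg _ F.adj_zero_neg_ey _, nodup_seg _ F.neg_ey_ne_zero _, head?_seg _ _ _, ?_,
    seg_ne_nil _ _ _⟩
  rw [vDown, getLast?_seg, fr_add_smul_neg_ey]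

/-- Westward segments: chain, no repetition, endpoints. [folklore] -/
theorem hWest_spec (a b : ℤ) (n : ℕ) :
    (F.hWest a b n).IsChain (zdGraph 2).Adj ∧ (F.hWest a b n).Nodup ∧
      (F.hWest a b n).head? = some (F.fr a b) ∧ (F.hWest a b n).getLast? = some (F.fr (a - n) b) ∧
      F.hWest a b n ≠ [] := by
  refine ⟨isChain_seg _ F.adj_zero_neg_ex _, nodup_seg _ F.neg_ex_ne_zero _, head?_seg _ _ _, ?_,
    seg_ne_nil _ _ _⟩
  rw [hWest, getLast?_seg, fr_add_smul_neg_ex]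

/-- From the front: one more downward step. [folklore] -/
theorem vDown_succ' (a b : ℤ) (n : ℕ) : F.vDown a b (n + 1) = F.fr a b :: F.vDown a (b - 1) n := by
  rw [vDown, seg_succ', vDown, show F.fr a b + -F.ey = F.fr a b + (1 : ℤ) • (-F.ey) by rw [one_smul],
    fr_add_smul_neg_ey]

/-- From the front: one more westward step. [folklore] -/
theorem hWest_succ' (a b : ℤ) (n : ℕ) : F.hWest a b (n + 1) = F.fr a b :: F.hWest (a - 1) b n := by
  rw [hWest, seg_succ', hWest, show F.fr a b + -F.ex = F.fr a b + (1 : ℤ) • (-F.ex) by rw [one_smul],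
    fr_add_smul_neg_ex]

end Frame

/-! ### The lanes -/

/-- Lane data: the frame, the pair abscissa/ordinate `α, β`, the right abscissa `xr` and top
ordinate `yu` of the arena, with `0 ≤ α`, `0 < xr` and `yu + 1 ≤ β`. [folklore] -/
structure LaneData where
  /-- the lane frame -/
  F : Frame
  /-- abscissa of the left point of the pair -/
  α : ℤ
  /-- ordinate of the right point of the pair -/
  β : ℤ
  /-- right abscissa of the arena -/
  xr : ℤ
  /-- top ordinate of the arena -/
  yu : ℤ
  /-- the pair lies in the right half -/
  hα : 0 ≤ α
  /-- the arena extends to the right of the axis -/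
  hxr : 0 < xr
  /-- the arena top row is non-negative -/
  hyu : 0 ≤ yu
  /-- the pair is above the arena -/
  hβ : yu + 1 ≤ β

namespace LaneData

variable (D : LaneData)

/-- The left point `L = fr α (β+1)` of the pair. [folklore] -/
def Lpt : Site 2 := D.F.fr D.α (D.β + 1)

/-- The right point `R = fr (α+1) β` of the pair. [folklore] -/
def Rpt : Site 2 := D.F.fr (D.α + 1) D.β

/-- Class V: both lane columns fit in the arena's abscissa range (`α + 1 ≤ xr`); otherwise class
BR (`xr ≤ α`). A decidable case PREDICATE on lane data — written with an explicit binder because it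
is not a closed named fact: both classes occur (`exists_isV`, `exists_not_isV`), so there is no
`IsV_holds` (`not_forall_isV`). [folklore] -/
def IsV (D : LaneData) : Prop := D.α + 1 ≤ D.xr

/-- Class V is decidable. [folklore] -/
instance : Decidable D.IsV := by unfold IsV; infer_instance

/-- Class V occurs (e.g. `α = 0`, `xr = 1`, `β = 1`, `yu = 0` in the standard frame). [folklore] -/
theorem exists_isV : ∃ D : LaneData, D.IsV :=
  ⟨⟨Frame.std 0, 0, 1, 1, 0, le_rfl, one_pos, le_rfl, by norm_num⟩, by unfold IsV; norm_num⟩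

/-- Class BR occurs (e.g. `α = 1`, `xr = 1`, `β = 1`, `yu = 0` in the standard frame). [folklore] -/
theorem exists_not_isV : ∃ D : LaneData, ¬D.IsV :=
  ⟨⟨Frame.std 0, 1, 1, 1, 0, zero_le_one, one_pos, le_rfl, by norm_num⟩, by unfold IsV; norm_num⟩

/-- `IsV` is a genuine case distinction (classes V / BR of the template), not a statement that
holds for every lane datum: it admits no closed discharge. [folklore] -/
theorem not_forall_isV : ¬∀ D : LaneData, D.IsV := fun h =>
  exists_not_isV.elim fun D hD => hD (h D)

/-- The left arrival `fr (min α (xr-1)) yu`. [folklore] -/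
def arrL : Site 2 := D.F.fr (min D.α (D.xr - 1)) D.yu

/-- The right arrival `fr (min (α+1) xr) yu`. [folklore] -/
def arrR : Site 2 := D.F.fr (min (D.α + 1) D.xr) D.yu

/-- The left lane, from `L` to `arrL`. [folklore] -/
def laneL : List (Site 2) :=
  if D.IsV then D.F.vDown D.α (D.β + 1) (D.β + 1 - D.yu).toNat
  else D.F.vDown D.α (D.β + 1) (D.β - D.yu).toNat ++
    (D.F.hWest D.α (D.yu + 1) (D.α - D.xr + 1).toNat).tail ++ [D.F.fr (D.xr - 1) D.yu]

/-- The right lane, from `R` to `arrR`. [folklore] -/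
def laneR : List (Site 2) :=
  if D.IsV then D.F.vDown (D.α + 1) D.β (D.β - D.yu).toNat
  else D.F.vDown (D.α + 1) D.β (D.β - D.yu).toNat ++ (D.F.hWest (D.α + 1) D.yu (D.α + 1 - D.xr).toNat).tail

/-- **Sites of the left lane**: abscissa in `[0, α]`, ordinate in `[yu, β+1]`, `fx + fy ≤ α + β + 1`,
and on the row `yu` only at the left arrival. [folklore] -/
theorem mem_laneL {w : Site 2} (h : w ∈ D.laneL) :
    0 ≤ D.F.fx w ∧ D.F.fx w ≤ D.α ∧ D.yu ≤ D.F.fy w ∧ D.F.fy w ≤ D.β + 1 ∧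
      D.F.fx w + D.F.fy w ≤ D.α + D.β + 1 ∧ (D.F.fy w = D.yu → w = D.arrL) ∧
      (D.F.fx w = D.α ∨ (¬D.IsV ∧ (D.F.fy w = D.yu + 1 ∨ w = D.arrL))) := by
  have hα := D.hα; have hxr := D.hxr; have hyu := D.hyu; have hβ := D.hβ
  rw [laneL] at h
  split_ifs at h with hV
  · have hn := Int.toNat_of_nonneg (show 0 ≤ D.β + 1 - D.yu by omega)
    obtain ⟨h1, h2, h3⟩ := D.F.coords_of_mem_vDown h
    rw [hn] at h2
    unfold IsV at hV
    refine ⟨by omega, by omega, by omega, by omega, by omega, fun hy => ?_, Or.inl h1⟩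
    rw [arrL, D.F.eq_fr_iff, min_eq_left (by omega)]; exact ⟨h1, hy⟩
  · unfold IsV at hV
    have hn1 := Int.toNat_of_nonneg (show 0 ≤ D.β - D.yu by omega)
    have hn2 := Int.toNat_of_nonneg (show 0 ≤ D.α - D.xr + 1 by omega)
    have harr : D.arrL = D.F.fr (D.xr - 1) D.yu := by rw [arrL, min_eq_right (by omega)]
    simp only [List.mem_append, List.mem_singleton] at h
    rcases h with (h | h) | rfl
    · obtain ⟨h1, h2, h3⟩ := D.F.coords_of_mem_vDown h
      rw [hn1] at h2
      refine ⟨by omega, by omega, by omega, by omega, by omega, fun hy => by omega, Or.inl h1⟩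
    · obtain ⟨h1, h2, h3⟩ := D.F.coords_of_mem_hWest (List.mem_of_mem_tail h)
      rw [hn2] at h2
      refine ⟨by omega, by omega, by omega, by omega, by omega, fun hy => by omega,
        Or.inr ⟨hV, Or.inl h1⟩⟩
    · simp only [Frame.fx_fr, Frame.fy_fr]
      refine ⟨by omega, by omega, le_rfl, by omega, by omega, fun _ => harr.symm, Or.inr ⟨hV, Or.inr harr.symm⟩⟩

/-- **Sites of the right lane**: abscissa in `[1, α+1]`, ordinate in `[yu, β]`, `fx + fy ≤ α + β + 1`,
on the row `yu` only at the right arrival; either on the column `α + 1` or (class BR) on the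
row `yu`. [folklore] -/
theorem mem_laneR {w : Site 2} (h : w ∈ D.laneR) :
    1 ≤ D.F.fx w ∧ D.F.fx w ≤ D.α + 1 ∧ D.yu ≤ D.F.fy w ∧ D.F.fy w ≤ D.β ∧
      D.F.fx w + D.F.fy w ≤ D.α + D.β + 1 ∧ (D.F.fy w = D.yu → D.F.fx w ≤ D.xr → w = D.arrR) ∧
      (D.F.fx w = D.α + 1 ∨ (¬D.IsV ∧ D.F.fy w = D.yu ∧ D.xr ≤ D.F.fx w)) := by
  have hα := D.hα; have hxr := D.hxr; have hyu := D.hyu; have hβ := D.hβ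
  rw [laneR] at h
  have hn1 := Int.toNat_of_nonneg (show 0 ≤ D.β - D.yu by omega)
  split_ifs at h with hV
  · obtain ⟨h1, h2, h3⟩ := D.F.coords_of_mem_vDown h
    rw [hn1] at h2
    unfold IsV at hV
    refine ⟨by omega, by omega, by omega, by omega, by omega, fun hy _ => ?_, Or.inl h1⟩
    rw [arrR, D.F.eq_fr_iff, min_eq_left (by omega)]; exact ⟨h1, hy⟩
  · unfold IsV at hV
    have hn2 := Int.toNat_of_nonneg (show 0 ≤ D.α + 1 - D.xr by omega)
    have harr : D.arrR = D.F.fr D.xr D.yu := by rw [arrR, min_eq_right (by omega)]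
    simp only [List.mem_append] at h
    rcases h with h | h
    · obtain ⟨h1, h2, h3⟩ := D.F.coords_of_mem_vDown h
      rw [hn1] at h2
      refine ⟨by omega, by omega, by omega, by omega, by omega, fun hy hx => by omega, Or.inl h1⟩
    · obtain ⟨h1, h2, h3⟩ := D.F.coords_of_mem_hWest (List.mem_of_mem_tail h)
      rw [hn2] at h2
      refine ⟨by omega, by omega, by omega, by omega, by omega, fun _ hx => ?_, Or.inr ⟨hV, h1, by omega⟩⟩
      rw [harr, D.F.eq_fr_iff]; exact ⟨by omega, h1⟩

/-- Gluing a vertical segment and the tail of a horizontal one starting at its end. [folklore] -/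
theorem glue_spec {a b : ℤ} {n : ℕ} {k : ℕ} :
    (D.F.vDown a b n ++ (D.F.hWest a (b - n) k).tail).IsChain (zdGraph 2).Adj ∧
      (D.F.vDown a b n ++ (D.F.hWest a (b - n) k).tail).Nodup ∧
      (D.F.vDown a b n ++ (D.F.hWest a (b - n) k).tail).head? = some (D.F.fr a b) ∧
      (D.F.vDown a b n ++ (D.F.hWest a (b - n) k).tail).getLast? = some (D.F.fr (a - k) (b - n)) := by
  obtain ⟨hc1, hn1, hh1, hl1, hne1⟩ := D.F.vDown_spec a b n
  obtain ⟨hc2, hn2, hh2, hl2, hne2⟩ := D.F.hWest_spec a (b - n) k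
  cases k with
  | zero =>
    simp only [Frame.hWest, seg, zero_add, List.range_one, List.map_cons, List.map_nil, Nat.cast_zero,
      zero_smul, add_zero, List.tail_cons, List.append_nil]
    exact ⟨hc1, hn1, hh1, by simpa using hl1⟩
  | succ k =>
    rw [Frame.hWest_succ'] at hc2 hn2 hl2 ⊢
    simp only [List.tail_cons]
    obtain ⟨init, hinit⟩ := List.getLast?_eq_some_iff.1 hl1
    refine ⟨?_, ?_, ?_, ?_⟩
    · have := List.IsChain.append_overlap (l₂ := [D.F.fr a (b - n)]) (hinit ▸ hc1) hc2 (by simp)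
      rw [hinit]
      simpa [List.append_assoc, Frame.hWest] using this
    · rw [List.nodup_append]
      refine ⟨hn1, (List.nodup_cons.1 hn2).2, fun x hx y hy hxy => ?_⟩
      subst hxy
      have h1 := (D.F.coords_of_mem_vDown hx).1
      have h2 := (D.F.coords_of_mem_hWest hy).2.2
      omega
    · rw [List.head?_append, hh1]; rfl
    · rw [List.getLast?_append, (D.F.hWest_spec (a - 1) (b - n) k).2.2.2.1]
      simp only [Option.some_or]
      congr 1
      rw [show a - 1 - (k : ℕ) = a - ((k + 1 : ℕ) : ℤ) by push_cast; ring]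

/-- **The lanes**: disjoint self-avoiding chains from the pair to the arrivals. [folklore] -/
theorem lanes_spec :
    D.laneL.IsChain (zdGraph 2).Adj ∧ D.laneR.IsChain (zdGraph 2).Adj ∧ D.laneL.Nodup ∧ D.laneR.Nodup ∧
      D.laneL.head? = some D.Lpt ∧ D.laneR.head? = some D.Rpt ∧
      D.laneL.getLast? = some D.arrL ∧ D.laneR.getLast? = some D.arrR ∧
      List.Disjoint D.laneL D.laneR ∧ D.laneL ≠ [] ∧ D.laneR ≠ [] := by
  have hα := D.hα; have hxr := D.hxr; have hyu := D.hyu; have hβ := D.hβ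
  have hdis : List.Disjoint D.laneL D.laneR := by
    intro w hw hw'
    have h1 := D.mem_laneL hw
    have h2 := D.mem_laneR hw'
    rcases h1.2.2.2.2.2.2 with h | ⟨hV, h | h⟩ <;> rcases h2.2.2.2.2.2.2 with h' | ⟨hV', h', h''⟩
    · omega
    · have hw := h1.2.2.2.2.2.1 h'
      rw [hw, arrL, Frame.fx_fr] at h''
      unfold IsV at hV'
      rw [min_eq_right (by omega)] at h''
      omega
    · omega
    · omega
    · rw [h, arrL, Frame.fx_fr, Frame.fy_fr] at h1
      unfold IsV at hV
      rw [min_eq_right (by omega)] at h1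
      have := h2.2.2.1
      rw [h] at this h'
      simp only [arrL, Frame.fx_fr, Frame.fy_fr] at this h'
      omega
    · rw [h, arrL, Frame.fx_fr] at h''
      unfold IsV at hV
      rw [min_eq_right (by omega)] at h''
      omega
  by_cases hV : D.IsV
  · have hV' := hV; unfold IsV at hV'
    obtain ⟨hc1, hn1, hh1, hl1, hne1⟩ := D.F.vDown_spec D.α (D.β + 1) (D.β + 1 - D.yu).toNat
    obtain ⟨hc2, hn2, hh2, hl2, hne2⟩ := D.F.vDown_spec (D.α + 1) D.β (D.β - D.yu).toNat
    have hdis' := hdis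
    simp only [laneL, laneR, hV, if_true] at hdis' ⊢
    refine ⟨hc1, hc2, hn1, hn2, hh1, hh2, ?_, ?_, hdis', hne1, hne2⟩
    · rw [hl1, arrL, min_eq_left (by omega), Int.toNat_of_nonneg (by omega)]; congr 1; ring
    · rw [hl2, arrR, min_eq_left (by omega), Int.toNat_of_nonneg (by omega)]; congr 1; ring
  · have hV' := hV; unfold IsV at hV'
    have hdis' := hdis
    simp only [laneL, laneR, hV, if_false] at hdis' ⊢
    have hn1 := Int.toNat_of_nonneg (show 0 ≤ D.β - D.yu by omega)
    -- right lane: glue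
    have eR : D.β - ((D.β - D.yu).toNat : ℕ) = D.yu := by rw [hn1]; ring
    have gR := D.glue_spec (a := D.α + 1) (b := D.β) (n := (D.β - D.yu).toNat) (k := (D.α + 1 - D.xr).toNat)
    rw [eR] at gR
    obtain ⟨hcR, hnR, hhR, hlR⟩ := gR
    -- left lane: glue then one more point
    have eL : D.β + 1 - ((D.β - D.yu).toNat : ℕ) = D.yu + 1 := by rw [hn1]; ring
    have gL := D.glue_spec (a := D.α) (b := D.β + 1) (n := (D.β - D.yu).toNat) (k := (D.α - D.xr + 1).toNat)
    rw [eL] at gL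
    obtain ⟨hcL, hnL, hhL, hlL⟩ := gL
    have hlast : D.F.fr (D.α - ((D.α - D.xr + 1).toNat : ℕ)) (D.yu + 1) = D.F.fr (D.xr - 1) (D.yu + 1) := by
      rw [Int.toNat_of_nonneg (by omega)]; congr 1; ring
    rw [hlast] at hlL
    obtain ⟨initL, hinitL⟩ := List.getLast?_eq_some_iff.1 hlL
    refine ⟨?_, hcR, ?_, hnR, ?_, hhR, ?_, ?_, hdis', by simp, ?_⟩
    · have hpair : ([D.F.fr (D.xr - 1) (D.yu + 1)] ++ [D.F.fr (D.xr - 1) D.yu]).IsChain (zdGraph 2).Adj := by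
        rw [List.singleton_append, List.isChain_pair, Frame.adj_fr_iff]; omega
      have := List.IsChain.append_overlap (l₂ := [D.F.fr (D.xr - 1) (D.yu + 1)]) (hinitL ▸ hcL) hpair
        (by simp)
      rw [hinitL]
      simpa [List.append_assoc] using this
    · rw [List.nodup_append]
      refine ⟨hnL, List.nodup_singleton _, fun x hx y hy hxy => ?_⟩
      rw [List.mem_singleton] at hy
      subst hy; subst hxy
      rcases List.mem_append.1 hx with hx | hx
      · have := (D.F.coords_of_mem_vDown hx).1; simp only [Frame.fx_fr] at this; omega
      · have := (D.F.coords_of_mem_hWest (List.mem_of_mem_tail hx)).1; simp only [Frame.fy_fr] at this; omega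
    · rw [List.head?_append, hhL]; rfl
    · rw [List.getLast?_append, List.getLast?_singleton, arrL, min_eq_right (by omega)]; rfl
    · rw [hlR, arrR, min_eq_right (by omega), Int.toNat_of_nonneg (by omega)]; congr 2; ring
    · rw [← List.length_pos_iff, List.length_append]
      have := (D.F.vDown_spec (D.α + 1) D.β (D.β - D.yu).toNat).2.2.2.2
      have := List.length_pos_iff.2 this
      omega

end LaneData

end Literature.Probability.RandomPlanarGeometry.SAW
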